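/-
Copyright (c) 2026 the pub-hodgecm-mathlib formalisation cell (harness21).  Prover seat hodgecm-mathlib-LH4-p01 (g10), carve (c6) «R IS GLUED» of SIG-F3-5 v1 6925585c
(F3-5 pen LH7-p04 (g11→g12) ∕ LH10-p01 (g10); road M6 → F3 «TOT-Λ by over-orders», route (B), LEAD F0P3a-plan T14-66; dealer LH4-plan), 2026-09-03.  FILE 2 of 2.
-/
import Literature.NumberTheory.Automorphic.GluedOverOrderOfEisensteinPair   -- FILE 1 (this seat): `exists_coe_range_eval₂_eq_glued` (R is glued), `level_of_eisenstein_pair ∕ _of_deep` (level law); brings ★ F3-3 FILE 1 `map_mem_span_pow_of_mem_span_pow`, ★ (L2′) `inv_mem_range_eval₂_eisenstein`, `const_mem_range_eval₂`, `gen_mem_range_eval₂`, `map_k₀_mem_maximalIdeal`, ★ O1 `IsUniformizingElement`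
import Literature.NumberTheory.Automorphic.GluedOverOrders                  -- ★ F3-1a (LH7-p04 (g11) p852926): the glued literal `G(N″, b, c′)`, `image_prodMap_glued`, `glued_subset_glued_iff`, `glued_eq_glued_iff`, (S4) `exists_map_rep_of_sub_mem_span`
import HarnessLib

/-!
# A unitary Eisenstein pair generates a `⋆`-stable glued order with a fixed character at a monogenic level (FILE 2 of 2; FILE 1 = `GluedOverOrderOfEisensteinPair`)
# (Neukirch I §12; Serre, Corps locaux I §6, X §1; Jacobowitz §4, §7; Rogawski 1990 §4.9)

Topic `NumberTheory/Automorphic`; namespace `Literature.NumberTheory.Automorphic`.  THEOREMS ONLY (no definition, no instance, no notation, no named fact, no `sorry`).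
Cell `pub/hodgecm-mathlib` (D-0151), crux H413 = `stmt-HodgeConjecture-24833`; road M6 → F3 «TOT-Λ by over-orders» (route (B)); carve **(c6) «R IS GLUED»** of SIG-F3-5 v1
(S2), FILE 2: the HEADS — the CONVERSE of ★ (UG) `exists_unitary_generator_glued` (LH4-p01 (g9) p852997).  CURRENCY = ★ F3-3 ∕ ★ (L3′) ∕ ★ F3-1a (the inert dictionary
`ιO : 𝒪_F → 𝒪_E`, `σO`; the abstract Eisenstein ring `O₁ = j𝒪_E ⊕ j𝒪_E θ` with `σ₁` over `σO` fixing `θ`; `R = 𝒪_E[(u, λ)]` as the range of `f ↦ f(u, λ)`; ★ F3-1a's glued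
literal `G(N, n, c)` spelled out at each use).
HONEST LABEL: HC_CM is proved only modulo the 7 printed citations (2 remaining named inputs: hLiu418 = stmt-HodgeConjecture-24832, h413 = stmt-HodgeConjecture-24833) until rung 0
closes; commutative algebra, count-neutral (pays no organ, opens no road; zero label movement until F5 ★ + desk rider).

THE MATHEMATICS.  FILE 1: `R = 𝒪_E[(u, λ)] = G(N, n, c)` with `q·c = ϖ^N·(u − p)` and the level law `n = min(2·ord c, 2N+1)`.  Here: if `x = (u, λ)` is UNITARY (`x·x⋆ = 1`,
`⋆ = (σO, σ₁)`) then `x⋆ = x⁻¹ ∈ R` (★ (L2′) inverse-closedness) and `⋆(f(x)) = f^{σO}(x⋆)`, so `⋆R ⊆ R`, hence `⋆R = R` (§1); by ★ F3-1a (S3)+(S2) (`⋆G(N, n, c) =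
G(N, n, σO c)`, inclusion criterion) this says `σO c ≡ c (mod ϖ^n)` — the character is HERMITIAN (§1); ★ F3-1a (S4) (additive Hilbert 90 with the unramified trace-one element
`b₀ + σO b₀ = 1`) then gives a `σO`-fixed representative `ιO y`, `y ∈ 𝒪_F`, and the monogenic level of `c` transfers to `y` on the `F`-side (pull-back
`ιO y ∈ (ϖ^m) ⇒ y ∈ (ϖ_F^m)`, §2).  HEADS (§3): `R = G(N, n, ιO y)` with EITHER `n = 2N+1 ∧ y ∈ (ϖ_F^{N+1})` OR `n = 2M`, `M ≤ N`, `y ∈ (ϖ_F^M) ∖ (ϖ_F^{M+1})`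
(`M = 0` = the product order `𝒪 × O_N`), and for a DEEP pair (`u ≡ p ≡ 1`) the same with `1 ≤ M` — ★ (UG)'s `hlvl` TOKEN FOR TOKEN at `(b, N″) := (n, N)`.
No `2`-adic token, no `d`, no parity binder (T14-66 KILL clause honoured).
[cite: Neukirch1999, Ch. I §12] [cite: SerreLocalFields1979, Ch. I §6 Prop. 17–18; Ch. X §1] [cite: Jacobowitz1962, §4, §7] [cite: Rogawski1990, §4.9 Lemma 4.9.3 p. 56, Prop. 4.9.1 (b) p. 55]

* §1 `eval₂_mem_range_eval₂_of_mem`, **`image_prodMap_range_eval₂_subset`** ∕ `image_prodMap_range_eval₂_eq_self` (`⋆R = R` for a unitary pair),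
  `map_sub_mem_span_of_image_prodMap_subset` (`⋆`-stable ⇒ hermitian).
* §2 `mem_span_pow_of_map_mem_span_pow` (`F`-side pull-back of the level), `exists_map_rep_of_level` (the fixed representative keeps the level).
* §3 **`exists_coe_range_eval₂_eq_glued_map`**, **`exists_coe_range_eval₂_eq_glued_map_of_deep`** (HEADS: `R = G(N, n, ιO y)`, `y` at a monogenic level).

## References
* [Neukirch1999] J. Neukirch, *Algebraic Number Theory*, Grundlehren 322 (1999): Ch. I §12 (orders, conductors; orders in products as fibre products).
* [SerreLocalFields1979] J.-P. Serre, *Local Fields*, GTM 67 (1979): Ch. I §6 Prop. 17–18 (uniformiser bookkeeping); Ch. X §1 (Hilbert 90, additive form).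
* [Jacobowitz1962] R. Jacobowitz, *Hermitian forms over local fields*, Amer. J. Math. 84 (1962): §4, §7 (involution-stable orders of hermitian lattices).
* [Rogawski1990] J. D. Rogawski, *Automorphic Representations of Unitary Groups in Three Variables*, Ann. of Math. Stud. 123 (1990): §4.9 Lemma 4.9.3 p. 56, Prop. 4.9.1 (b) p. 55
  (the type-(2) orders `𝒪[γ]` and their invariants `(N, n)`).
-/

set_option autoImplicit false

noncomputable section

open scoped ValuativeRel
open Polynomial ValuativeRel

namespace Literature.NumberTheory.Automorphic

variable {E : Type*} [Field E] [ValuativeRel E] {O₁ : Type*} [CommRing O₁] (j : 𝒪[E] →+* O₁) (θ : O₁)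

/-! ## §1 A unitary pair: `⋆R = R` and the character is hermitian -/

/-- Polynomials in an element of `R = 𝒪[x]` with constant coefficients stay in `R`. [cite: Neukirch1999, Ch. I §12] -/
theorem eval₂_mem_range_eval₂_of_mem {u : 𝒪[E]} {lam : O₁} {y : 𝒪[E] × O₁}
    (hy : y ∈ (Polynomial.eval₂RingHom (RingHom.prod (RingHom.id 𝒪[E]) j) ((u, lam) : 𝒪[E] × O₁)).range) (g : (𝒪[E])[X]) :
    g.eval₂ (RingHom.prod (RingHom.id 𝒪[E]) j) y ∈ (Polynomial.eval₂RingHom (RingHom.prod (RingHom.id 𝒪[E]) j) ((u, lam) : 𝒪[E] × O₁)).range := by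
  set R := (Polynomial.eval₂RingHom (RingHom.prod (RingHom.id 𝒪[E]) j) ((u, lam) : 𝒪[E] × O₁)).range with hR
  induction g using Polynomial.induction_on' with
  | add p₁ p₂ hp₁ hp₂ => rw [eval₂_add]; exact R.add_mem hp₁ hp₂
  | monomial m c =>
    rw [eval₂_monomial, RingHom.prod_apply, RingHom.id_apply]
    exact R.mul_mem (const_mem_range_eval₂ j u c) (R.pow_mem hy m)

section Star

variable (σO : 𝒪[E] →+* 𝒪[E]) (σ₁ : O₁ →+* O₁)

/-- **`⋆R ⊆ R` FOR A UNITARY PAIR**: if `x = (u, λ)` satisfies `x·x⋆ = 1` (`⋆ = (σO, σ₁)`, `σ₁ ∘ j = j ∘ σO`) then the involution maps `R = 𝒪[x]` into itself — `x⋆ = x⁻¹ ∈ R`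
by ★ (L2′)'s inverse-closedness, and `⋆(f(x)) = f^{σO}(x⋆)`. [cite: Jacobowitz1962, §4] [cite: Neukirch1999, Ch. I §12] -/
theorem image_prodMap_range_eval₂_subset {a k : 𝒪[E]} (hθ : θ ^ 2 = j a * θ + j k) (ha : a ∈ IsLocalRing.maximalIdeal 𝒪[E])
    (hk : k ∈ IsLocalRing.maximalIdeal 𝒪[E]) (hcoord : ∀ z : O₁, ∃! bc : 𝒪[E] × 𝒪[E], z = j bc.1 + j bc.2 * θ)
    (hσ₁j : ∀ x, σ₁ (j x) = j (σO x)) {u : 𝒪[E]} {lam : O₁}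
    (hxstar : ((u, lam) : 𝒪[E] × O₁) * RingHom.prodMap σO σ₁ (u, lam) = 1) :
    RingHom.prodMap σO σ₁ '' ((Polynomial.eval₂RingHom (RingHom.prod (RingHom.id 𝒪[E]) j) ((u, lam) : 𝒪[E] × O₁)).range : Set (𝒪[E] × O₁)) ⊆
      (Polynomial.eval₂RingHom (RingHom.prod (RingHom.id 𝒪[E]) j) ((u, lam) : 𝒪[E] × O₁)).range := by
  set R := (Polynomial.eval₂RingHom (RingHom.prod (RingHom.id 𝒪[E]) j) ((u, lam) : 𝒪[E] × O₁)).range with hR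
  set x : 𝒪[E] × O₁ := (u, lam) with hx
  have hxu : IsUnit x := IsUnit.of_mul_eq_one _ hxstar
  have hinv : (↑hxu.unit⁻¹ : 𝒪[E] × O₁) = RingHom.prodMap σO σ₁ x :=
    Units.inv_eq_of_mul_eq_one_right (by rw [IsUnit.unit_spec]; exact hxstar)
  have hstarx : RingHom.prodMap σO σ₁ x ∈ R := by
    rw [← hinv]
    exact inv_mem_range_eval₂_eisenstein j θ u hθ ha hk hcoord hxu (gen_mem_range_eval₂ j u)
  have hcomp : (RingHom.prodMap σO σ₁).comp (RingHom.prod (RingHom.id 𝒪[E]) j) = (RingHom.prod (RingHom.id 𝒪[E]) j).comp σO := by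
    refine RingHom.ext fun c => Prod.ext ?_ ?_
    · simp
    · simp [hσ₁j]
  rintro _ ⟨z, hz, rfl⟩
  obtain ⟨f, rfl⟩ := hz
  rw [Polynomial.coe_eval₂RingHom, Polynomial.hom_eval₂, hcomp, ← Polynomial.eval₂_map]
  exact eval₂_mem_range_eval₂_of_mem j hstarx (f.map σO)

/-- **`⋆R = R` FOR A UNITARY PAIR** (with `σO`, hence `σ₁`, an involution). [cite: Jacobowitz1962, §4] [cite: Neukirch1999, Ch. I §12] -/
theorem image_prodMap_range_eval₂_eq_self {a k : 𝒪[E]} (hθ : θ ^ 2 = j a * θ + j k) (ha : a ∈ IsLocalRing.maximalIdeal 𝒪[E])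
    (hk : k ∈ IsLocalRing.maximalIdeal 𝒪[E]) (hcoord : ∀ z : O₁, ∃! bc : 𝒪[E] × 𝒪[E], z = j bc.1 + j bc.2 * θ)
    (hσσ : ∀ x, σO (σO x) = x) (hσ₁j : ∀ x, σ₁ (j x) = j (σO x)) (hσ₁θ : σ₁ θ = θ) {u : 𝒪[E]} {lam : O₁}
    (hxstar : ((u, lam) : 𝒪[E] × O₁) * RingHom.prodMap σO σ₁ (u, lam) = 1) :
    RingHom.prodMap σO σ₁ '' ((Polynomial.eval₂RingHom (RingHom.prod (RingHom.id 𝒪[E]) j) ((u, lam) : 𝒪[E] × O₁)).range : Set (𝒪[E] × O₁)) =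
      (Polynomial.eval₂RingHom (RingHom.prod (RingHom.id 𝒪[E]) j) ((u, lam) : 𝒪[E] × O₁)).range := by
  have hσ₁σ₁ : ∀ w : O₁, σ₁ (σ₁ w) = w := by
    intro w
    obtain ⟨⟨b₁, c₁⟩, hw, -⟩ := hcoord w
    rw [hw]
    simp only [map_add, map_mul, hσ₁j, hσ₁θ, hσσ]
  have hinv : ∀ w : 𝒪[E] × O₁, RingHom.prodMap σO σ₁ (RingHom.prodMap σO σ₁ w) = w := by
    rintro ⟨y, x⟩; ext <;> simp [hσσ, hσ₁σ₁]
  have hsub := image_prodMap_range_eval₂_subset j θ σO σ₁ hθ ha hk hcoord hσ₁j hxstar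
  refine Set.Subset.antisymm hsub fun w hw => ?_
  exact ⟨RingHom.prodMap σO σ₁ w, hsub ⟨w, hw, rfl⟩, hinv w⟩

/-- **THE CHARACTER OF A `⋆`-STABLE GLUED ORDER IS HERMITIAN**: `⋆(G(N, n, c)) ⊆ G(N, n, c) ⇒ σO c ≡ c (mod ϖ^n)` (★ F3-1a (S3) + (S2)).
[cite: Jacobowitz1962, §4, §7] [cite: Neukirch1999, Ch. I §12] -/
theorem map_sub_mem_span_of_image_prodMap_subset
    (hcoord : ∀ z : O₁, ∃! bc : 𝒪[E] × 𝒪[E], z = j bc.1 + j bc.2 * θ)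
    (hσσ : ∀ x, σO (σO x) = x) (hσ₁j : ∀ x, σ₁ (j x) = j (σO x)) (hσ₁θ : σ₁ θ = θ)
    {ϖ : E} (hϖ : IsUniformizingElement ϖ) (hσπ : σO ⟨ϖ, hϖ.mem⟩ = ⟨ϖ, hϖ.mem⟩) {N n : ℕ} {c : 𝒪[E]}
    (h : RingHom.prodMap σO σ₁ '' {z : 𝒪[E] × O₁ | ∃ b₀ c₀ : 𝒪[E], z.2 = j b₀ + j c₀ * (j ((⟨ϖ, hϖ.mem⟩ : 𝒪[E]) ^ N) * θ) ∧
        z.1 - (b₀ + c₀ * c) ∈ Ideal.span {(⟨ϖ, hϖ.mem⟩ : 𝒪[E]) ^ n}} ⊆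
      {z : 𝒪[E] × O₁ | ∃ b₀ c₀ : 𝒪[E], z.2 = j b₀ + j c₀ * (j ((⟨ϖ, hϖ.mem⟩ : 𝒪[E]) ^ N) * θ) ∧
        z.1 - (b₀ + c₀ * c) ∈ Ideal.span {(⟨ϖ, hϖ.mem⟩ : 𝒪[E]) ^ n}}) :
    σO c - c ∈ Ideal.span {(⟨ϖ, hϖ.mem⟩ : 𝒪[E]) ^ n} := by
  set π : 𝒪[E] := ⟨ϖ, hϖ.mem⟩ with hπdef
  have hπnu : ¬ IsUnit π := by
    have hm : π ∈ IsLocalRing.maximalIdeal 𝒪[E] := by rw [hϖ.span_eq]; exact Ideal.mem_span_singleton_self _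
    exact (IsLocalRing.mem_maximalIdeal _).1 hm
  rw [image_prodMap_glued j θ π hcoord σO σ₁ hσσ hσ₁j hσ₁θ hσπ N n c] at h
  obtain ⟨-, -, hcomp⟩ := (glued_subset_glued_iff j θ π hcoord (σO c) c hϖ.coe_ne_zero hπnu).1 h
  rw [Nat.sub_self, pow_zero, one_mul] at hcomp
  rw [← neg_sub]
  exact (Ideal.span {π ^ n}).neg_mem hcomp

/-! ## §2 The fixed representative keeps the level -/

variable {F : Type*} [Field F] [ValuativeRel F] (ιO : 𝒪[F] →+* 𝒪[E])

/-- **`F`-SIDE PULL-BACK OF THE LEVEL**: `ιO y ∈ (ϖ^m) ⇒ y ∈ (ϖ_F^m)` (`ιO ϖ_F = ϖ`; ring maps send units to units, so a unit of `𝒪_F` cannot land in `(ϖ)`) — the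
injectivity-free, one-directional form of ★ (ii) `map_mem_span_pow_iff` (converse = ★ FILE 1 `map_mem_span_pow_of_mem_span_pow`). [cite: SerreLocalFields1979, Ch. I §6] -/
theorem mem_span_pow_of_map_mem_span_pow {ϖF : F} {ϖ : E} (hϖF : IsUniformizingElement ϖF) (hϖ : IsUniformizingElement ϖ)
    (hιϖ : ιO ⟨ϖF, hϖF.mem⟩ = ⟨ϖ, hϖ.mem⟩) {y : 𝒪[F]} {m : ℕ}
    (hy : ιO y ∈ Ideal.span ({(⟨ϖ, hϖ.mem⟩ : 𝒪[E]) ^ m} : Set 𝒪[E])) :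
    y ∈ Ideal.span ({(⟨ϖF, hϖF.mem⟩ : 𝒪[F]) ^ m} : Set 𝒪[F]) := by
  set π : 𝒪[E] := ⟨ϖ, hϖ.mem⟩ with hπdef
  set πF : 𝒪[F] := ⟨ϖF, hϖF.mem⟩ with hπFdef
  have hπnu : ¬ IsUnit π := by
    have hm : π ∈ IsLocalRing.maximalIdeal 𝒪[E] := by rw [hϖ.span_eq]; exact Ideal.mem_span_singleton_self _
    exact (IsLocalRing.mem_maximalIdeal _).1 hm
  induction m generalizing y with
  | zero => simp
  | succ m ih =>
    have hle : Ideal.span ({π ^ (m + 1)} : Set 𝒪[E]) ≤ Ideal.span {π ^ m} :=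
      Ideal.span_singleton_le_span_singleton.2 (pow_dvd_pow π (Nat.le_succ m))
    obtain ⟨y₁, hy₁⟩ := Ideal.mem_span_singleton'.1 (ih (hle hy))
    obtain ⟨r, hr⟩ := Ideal.mem_span_singleton'.1 hy
    have h1 : ιO y₁ * π ^ m = r * π * π ^ m := by
      rw [mul_assoc, ← pow_succ', hr, ← hy₁, map_mul, map_pow, hιϖ]
    have h2 : ιO y₁ = r * π := mul_right_cancel₀ (pow_ne_zero _ hϖ.coe_ne_zero) h1
    have h3 : ¬ IsUnit y₁ := fun hu => by
      have hu' : IsUnit (ιO y₁) := hu.map ιO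
      rw [h2] at hu'
      exact hπnu (isUnit_of_mul_isUnit_right hu')
    have h4 : y₁ ∈ Ideal.span ({πF} : Set 𝒪[F]) := by
      rw [hπFdef, ← hϖF.span_eq]; exact (IsLocalRing.mem_maximalIdeal _).2 h3
    obtain ⟨y₂, hy₂⟩ := Ideal.mem_span_singleton'.1 h4
    refine Ideal.mem_span_singleton'.2 ⟨y₂, ?_⟩
    rw [pow_succ', ← mul_assoc, hy₂, hy₁]

/-- **THE FIXED REPRESENTATIVE KEEPS THE LEVEL.**  If `R = G(N, n, c)` with `c` HERMITIAN (`σO c ≡ c (mod ϖ^n)`) and `c` at a monogenic level (`n = 2N+1 ∧ c ∈ (ϖ^{N+1})`, or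
`n = 2M`, `1 ≤ M ≤ N`, `c ∈ (ϖ^M) ∖ (ϖ^{M+1})`), then `R = G(N, n, ιO y)` for some `y ∈ 𝒪_F` at the SAME level on the `F`-side (★ F3-1a (S4) additive Hilbert 90 with the unramified
trace-one element, `glued_eq_glued_iff`, and the pull-back `mem_span_pow_of_map_mem_span_pow`). [cite: SerreLocalFields1979, Ch. X §1] [cite: Neukirch1999, Ch. I §12] -/
theorem exists_map_rep_of_level (hσσ : ∀ x, σO (σO x) = x) (hfixO : ∀ x, σO x = x → ∃ y, ιO y = x)
    (hcoord : ∀ z : O₁, ∃! bc : 𝒪[E] × 𝒪[E], z = j bc.1 + j bc.2 * θ) (htr : ∃ b₀ : 𝒪[E], b₀ + σO b₀ = 1)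
    {ϖF : F} {ϖ : E} (hϖF : IsUniformizingElement ϖF) (hϖ : IsUniformizingElement ϖ) (hιϖ : ιO ⟨ϖF, hϖF.mem⟩ = ⟨ϖ, hϖ.mem⟩)
    {N n : ℕ} {c : 𝒪[E]} (hherm : σO c - c ∈ Ideal.span {(⟨ϖ, hϖ.mem⟩ : 𝒪[E]) ^ n})
    (hlvl : (n = 2 * N + 1 ∧ c ∈ Ideal.span {(⟨ϖ, hϖ.mem⟩ : 𝒪[E]) ^ (N + 1)}) ∨
      ∃ M : ℕ, 1 ≤ M ∧ M ≤ N ∧ n = 2 * M ∧ c ∈ Ideal.span {(⟨ϖ, hϖ.mem⟩ : 𝒪[E]) ^ M} ∧ c ∉ Ideal.span {(⟨ϖ, hϖ.mem⟩ : 𝒪[E]) ^ (M + 1)})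
    {R : Set (𝒪[E] × O₁)}
    (hR : R = {z : 𝒪[E] × O₁ | ∃ b₀ c₀ : 𝒪[E], z.2 = j b₀ + j c₀ * (j ((⟨ϖ, hϖ.mem⟩ : 𝒪[E]) ^ N) * θ) ∧
        z.1 - (b₀ + c₀ * c) ∈ Ideal.span {(⟨ϖ, hϖ.mem⟩ : 𝒪[E]) ^ n}}) :
    ∃ y : 𝒪[F], R = {z : 𝒪[E] × O₁ | ∃ b₀ c₀ : 𝒪[E], z.2 = j b₀ + j c₀ * (j ((⟨ϖ, hϖ.mem⟩ : 𝒪[E]) ^ N) * θ) ∧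
        z.1 - (b₀ + c₀ * ιO y) ∈ Ideal.span {(⟨ϖ, hϖ.mem⟩ : 𝒪[E]) ^ n}} ∧
      ((n = 2 * N + 1 ∧ y ∈ Ideal.span {(⟨ϖF, hϖF.mem⟩ : 𝒪[F]) ^ (N + 1)}) ∨
        ∃ M : ℕ, 1 ≤ M ∧ M ≤ N ∧ n = 2 * M ∧ y ∈ Ideal.span {(⟨ϖF, hϖF.mem⟩ : 𝒪[F]) ^ M} ∧
          y ∉ Ideal.span {(⟨ϖF, hϖF.mem⟩ : 𝒪[F]) ^ (M + 1)}) := by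
  set π : 𝒪[E] := ⟨ϖ, hϖ.mem⟩ with hπdef
  set πF : 𝒪[F] := ⟨ϖF, hϖF.mem⟩ with hπFdef
  have hle : ∀ {a b : ℕ}, b ≤ a → Ideal.span ({π ^ a} : Set 𝒪[E]) ≤ Ideal.span {π ^ b} := fun {a b} h =>
    Ideal.span_singleton_le_span_singleton.2 (pow_dvd_pow π h)
  obtain ⟨y, hy⟩ := exists_map_rep_of_sub_mem_span π σO hσσ ιO hfixO htr hherm
  have hG := (glued_eq_glued_iff j θ π hcoord N n (ιO y) c hϖ.coe_ne_zero).2 hy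
  refine ⟨y, by rw [hR, hG], ?_⟩
  have hιy : ∀ {m : ℕ}, m ≤ n → c ∈ Ideal.span ({π ^ m} : Set 𝒪[E]) → ιO y ∈ Ideal.span ({π ^ m} : Set 𝒪[E]) := by
    intro m hm hc
    have : ιO y = (ιO y - c) + c := by ring
    rw [this]
    exact Ideal.add_mem _ (hle hm hy) hc
  rcases hlvl with ⟨hn, hc⟩ | ⟨M, hM1, hMN, hn, hcM, hcM1⟩
  · exact Or.inl ⟨hn, mem_span_pow_of_map_mem_span_pow ιO hϖF hϖ hιϖ (hιy (by omega) hc)⟩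
  · refine Or.inr ⟨M, hM1, hMN, hn, mem_span_pow_of_map_mem_span_pow ιO hϖF hϖ hιϖ (hιy (by omega) hcM), fun hyM1 => hcM1 ?_⟩
    have h1 : ιO y ∈ Ideal.span ({π ^ (M + 1)} : Set 𝒪[E]) := map_mem_span_pow_of_mem_span_pow ιO hϖF hϖ hιϖ hyM1
    have : c = ιO y - (ιO y - c) := by ring
    rw [this]
    exact Ideal.sub_mem _ h1 (hle (by omega) hy)

/-! ## §3 HEADS -/

/-- **(c6-C) HEAD — A UNITARY EISENSTEIN PAIR GENERATES A `⋆`-STABLE GLUED ORDER WITH A FIXED CHARACTER AT A MONOGENIC LEVEL.**  In the inert Eisenstein frame of ★ (UG) ∕ ★ (L3′)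
(`ιO σO` the unramified base with `hfixO`, `htr`; `O₁ = j𝒪_E ⊕ j𝒪_E θ`, `θ² = j(ιO a)θ + j(ιO k)`, `a ∈ 𝔪_F`, `k` a uniformiser class, `σ₁ θ = θ`; uniformisers `ιO ϖ_F = ϖ`):
for `x = (u, j p + j q θ)` UNITARY (`x·x⋆ = 1`) with `λ² − tλ + D = 0`, `v(q) = v(ϖ)^N`, `v(u² − tu + D) = v(ϖ)^n`, there is `y ∈ 𝒪_F` with
`𝒪_E[x] = G(N, n, ιO y)` (★ F3-1a's literal) and EITHER `n = 2N+1 ∧ y ∈ (ϖ_F^{N+1})` OR `n = 2M`, `M ≤ N`, `y ∈ (ϖ_F^M) ∖ (ϖ_F^{M+1})` (`M = 0`: the product order `𝒪 × O_N`).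
The CONVERSE of ★ (UG) `exists_unitary_generator_glued`; the input (S2) «R is glued» of F3-5. [cite: Rogawski1990, §4.9 Lemma 4.9.3 p. 56, Prop. 4.9.1 (b) p. 55] [cite: Neukirch1999, Ch. I §12] [cite: Jacobowitz1962, §7] [cite: SerreLocalFields1979, Ch. I §6 Prop. 17–18; Ch. X §1] -/
theorem exists_coe_range_eval₂_eq_glued_map {aF k₀F : 𝒪[F]}
    (hσσ : ∀ x, σO (σO x) = x) (hσι : ∀ y, σO (ιO y) = ιO y) (hfixO : ∀ x, σO x = x → ∃ y, ιO y = x)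
    (hιu : ∀ y, IsUnit (ιO y) → IsUnit y) (hσ₁j : ∀ x, σ₁ (j x) = j (σO x)) (hσ₁θ : σ₁ θ = θ)
    (hθ : θ ^ 2 = j (ιO aF) * θ + j (ιO k₀F)) (haF : aF ∈ IsLocalRing.maximalIdeal 𝒪[F]) (hk₀ : k₀F ∈ IsLocalRing.maximalIdeal 𝒪[F])
    (hcoord : ∀ z : O₁, ∃! bc : 𝒪[E] × 𝒪[E], z = j bc.1 + j bc.2 * θ) (htr : ∃ b₀ : 𝒪[E], b₀ + σO b₀ = 1)
    {ϖF : F} {ϖ : E} (hϖF : IsUniformizingElement ϖF) (hϖ : IsUniformizingElement ϖ) (hιϖ : ιO ⟨ϖF, hϖF.mem⟩ = ⟨ϖ, hϖ.mem⟩)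
    (hk₁ : valuation E ((ιO k₀F : 𝒪[E]) : E) = valuation E ϖ) {u p q t D : 𝒪[E]}
    (hlam2 : (j p + j q * θ) ^ 2 - j t * (j p + j q * θ) + j D = 0)
    (hxstar : ((u, j p + j q * θ) : 𝒪[E] × O₁) * RingHom.prodMap σO σ₁ (u, j p + j q * θ) = 1) {N n : ℕ}
    (hN : valuation E (q : E) = valuation E ϖ ^ N) (hn : valuation E ((u * u - t * u + D : 𝒪[E]) : E) = valuation E ϖ ^ n) :
    ∃ y : 𝒪[F],
      ((Polynomial.eval₂RingHom (RingHom.prod (RingHom.id 𝒪[E]) j) ((u, j p + j q * θ) : 𝒪[E] × O₁)).range : Set (𝒪[E] × O₁)) =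
        {z : 𝒪[E] × O₁ | ∃ b₀ c₀ : 𝒪[E], z.2 = j b₀ + j c₀ * (j ((⟨ϖ, hϖ.mem⟩ : 𝒪[E]) ^ N) * θ) ∧
          z.1 - (b₀ + c₀ * ιO y) ∈ Ideal.span {(⟨ϖ, hϖ.mem⟩ : 𝒪[E]) ^ n}} ∧
      ((n = 2 * N + 1 ∧ y ∈ Ideal.span {(⟨ϖF, hϖF.mem⟩ : 𝒪[F]) ^ (N + 1)}) ∨
        ∃ M : ℕ, M ≤ N ∧ n = 2 * M ∧ y ∈ Ideal.span {(⟨ϖF, hϖF.mem⟩ : 𝒪[F]) ^ M} ∧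
          y ∉ Ideal.span {(⟨ϖF, hϖF.mem⟩ : 𝒪[F]) ^ (M + 1)}) := by
  set π : 𝒪[E] := ⟨ϖ, hϖ.mem⟩ with hπdef
  set πF : 𝒪[F] := ⟨ϖF, hϖF.mem⟩ with hπFdef
  have ha : ιO aF ∈ IsLocalRing.maximalIdeal 𝒪[E] := map_k₀_mem_maximalIdeal ιO hιu haF
  have hk : ιO k₀F ∈ IsLocalRing.maximalIdeal 𝒪[E] := map_k₀_mem_maximalIdeal ιO hιu hk₀
  have hσπ : σO π = π := by rw [← hιϖ, hσι]
  obtain ⟨c, hqc, hR⟩ := exists_coe_range_eval₂_eq_glued j θ hϖ hlam2 hN hn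
  have hsub := image_prodMap_range_eval₂_subset j θ σO σ₁ hθ ha hk hcoord hσ₁j hxstar
  rw [hR] at hsub
  have hherm : σO c - c ∈ Ideal.span ({π ^ n} : Set 𝒪[E]) :=
    map_sub_mem_span_of_image_prodMap_subset j θ σO σ₁ hcoord hσσ hσ₁j hσ₁θ hϖ hσπ hsub
  rcases level_of_eisenstein_pair j θ hθ ha hϖ hk₁ hcoord hlam2 hqc hN hn with ⟨hnodd, hc⟩ | ⟨M, hMN, hnM, -, hcM, hcM1⟩
  · obtain ⟨y, hy, hlvl⟩ := exists_map_rep_of_level j θ σO ιO hσσ hfixO hcoord htr hϖF hϖ hιϖ hherm (Or.inl ⟨hnodd, hc⟩) hR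
    refine ⟨y, hy, ?_⟩
    rcases hlvl with h | ⟨M, -, hMN, hnM, hyM, hyM1⟩
    · exact Or.inl h
    · exact Or.inr ⟨M, hMN, hnM, hyM, hyM1⟩
  · rcases Nat.eq_zero_or_pos M with hM0 | hMpos
    · -- `n = 0`: the glue is vacuous, take `y = 1`
      subst hM0
      have hn0 : n = 0 := by omega
      refine ⟨1, ?_, Or.inr ⟨0, Nat.zero_le N, hnM, ?_, ?_⟩⟩
      · rw [hR]
        refine ((glued_eq_glued_iff j θ π hcoord N n (ιO 1) c hϖ.coe_ne_zero).2 ?_).symm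
        rw [hn0, pow_zero, Ideal.span_singleton_one]
        exact Submodule.mem_top
      · rw [pow_zero, Ideal.span_singleton_one]; exact Submodule.mem_top
      · rw [zero_add, pow_one, hπFdef, ← hϖF.span_eq]
        exact (Ideal.ne_top_iff_one _).1 (IsLocalRing.maximalIdeal.isMaximal 𝒪[F]).ne_top
    · obtain ⟨y, hy, hlvl⟩ := exists_map_rep_of_level j θ σO ιO hσσ hfixO hcoord htr hϖF hϖ hιϖ hherm
        (Or.inr ⟨M, hMpos, hMN, hnM, hcM, hcM1⟩) hR
      refine ⟨y, hy, ?_⟩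
      rcases hlvl with h | ⟨M', -, hMN', hnM', hyM, hyM1⟩
      · exact Or.inl h
      · exact Or.inr ⟨M', hMN', hnM', hyM, hyM1⟩

/-- **(c6-C′) HEAD, DEEP FORM — TOKEN-FOR-TOKEN CONVERSE OF ★ (UG).**  For a DEEP unitary Eisenstein pair (`u ≡ 1`, `p ≡ 1 (mod 𝔪_E)`) of exponents `(N, n)`:
`𝒪_E[(u, λ)] = G(N, n, ιO y)` with `y ∈ 𝒪_F` at a MONOGENIC level in exactly ★ (UG) `exists_unitary_generator_glued`'s `hlvl` tokens (`(b, N″) := (n, N)`):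
`(n = 2N+1 ∧ y ∈ (ϖ_F^{N+1})) ∨ ∃ M, 1 ≤ M ∧ M ≤ N ∧ n = 2M ∧ y ∈ (ϖ_F^M) ∧ y ∉ (ϖ_F^{M+1})`.
[cite: Rogawski1990, §4.9 Lemma 4.9.3 p. 56, Prop. 4.9.1 (b) p. 55] [cite: Neukirch1999, Ch. I §12] [cite: Jacobowitz1962, §7] [cite: SerreLocalFields1979, Ch. I §6 Prop. 17–18; Ch. X §1] -/
theorem exists_coe_range_eval₂_eq_glued_map_of_deep {aF k₀F : 𝒪[F]}
    (hσσ : ∀ x, σO (σO x) = x) (hσι : ∀ y, σO (ιO y) = ιO y) (hfixO : ∀ x, σO x = x → ∃ y, ιO y = x)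
    (hιu : ∀ y, IsUnit (ιO y) → IsUnit y) (hσ₁j : ∀ x, σ₁ (j x) = j (σO x)) (hσ₁θ : σ₁ θ = θ)
    (hθ : θ ^ 2 = j (ιO aF) * θ + j (ιO k₀F)) (haF : aF ∈ IsLocalRing.maximalIdeal 𝒪[F]) (hk₀ : k₀F ∈ IsLocalRing.maximalIdeal 𝒪[F])
    (hcoord : ∀ z : O₁, ∃! bc : 𝒪[E] × 𝒪[E], z = j bc.1 + j bc.2 * θ) (htr : ∃ b₀ : 𝒪[E], b₀ + σO b₀ = 1)
    {ϖF : F} {ϖ : E} (hϖF : IsUniformizingElement ϖF) (hϖ : IsUniformizingElement ϖ) (hιϖ : ιO ⟨ϖF, hϖF.mem⟩ = ⟨ϖ, hϖ.mem⟩)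
    (hk₁ : valuation E ((ιO k₀F : 𝒪[E]) : E) = valuation E ϖ) {u p q t D : 𝒪[E]}
    (hlam2 : (j p + j q * θ) ^ 2 - j t * (j p + j q * θ) + j D = 0)
    (hu1 : u - 1 ∈ IsLocalRing.maximalIdeal 𝒪[E]) (hp1 : p - 1 ∈ IsLocalRing.maximalIdeal 𝒪[E])
    (hxstar : ((u, j p + j q * θ) : 𝒪[E] × O₁) * RingHom.prodMap σO σ₁ (u, j p + j q * θ) = 1) {N n : ℕ}
    (hN : valuation E (q : E) = valuation E ϖ ^ N) (hn : valuation E ((u * u - t * u + D : 𝒪[E]) : E) = valuation E ϖ ^ n) :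
    ∃ y : 𝒪[F],
      ((Polynomial.eval₂RingHom (RingHom.prod (RingHom.id 𝒪[E]) j) ((u, j p + j q * θ) : 𝒪[E] × O₁)).range : Set (𝒪[E] × O₁)) =
        {z : 𝒪[E] × O₁ | ∃ b₀ c₀ : 𝒪[E], z.2 = j b₀ + j c₀ * (j ((⟨ϖ, hϖ.mem⟩ : 𝒪[E]) ^ N) * θ) ∧
          z.1 - (b₀ + c₀ * ιO y) ∈ Ideal.span {(⟨ϖ, hϖ.mem⟩ : 𝒪[E]) ^ n}} ∧
      ((n = 2 * N + 1 ∧ y ∈ Ideal.span {(⟨ϖF, hϖF.mem⟩ : 𝒪[F]) ^ (N + 1)}) ∨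
        ∃ M : ℕ, 1 ≤ M ∧ M ≤ N ∧ n = 2 * M ∧ y ∈ Ideal.span {(⟨ϖF, hϖF.mem⟩ : 𝒪[F]) ^ M} ∧
          y ∉ Ideal.span {(⟨ϖF, hϖF.mem⟩ : 𝒪[F]) ^ (M + 1)}) := by
  set π : 𝒪[E] := ⟨ϖ, hϖ.mem⟩ with hπdef
  have ha : ιO aF ∈ IsLocalRing.maximalIdeal 𝒪[E] := map_k₀_mem_maximalIdeal ιO hιu haF
  have hk : ιO k₀F ∈ IsLocalRing.maximalIdeal 𝒪[E] := map_k₀_mem_maximalIdeal ιO hιu hk₀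
  have hσπ : σO π = π := by rw [← hιϖ, hσι]
  obtain ⟨c, hqc, hR⟩ := exists_coe_range_eval₂_eq_glued j θ hϖ hlam2 hN hn
  have hsub := image_prodMap_range_eval₂_subset j θ σO σ₁ hθ ha hk hcoord hσ₁j hxstar
  rw [hR] at hsub
  have hherm : σO c - c ∈ Ideal.span ({π ^ n} : Set 𝒪[E]) :=
    map_sub_mem_span_of_image_prodMap_subset j θ σO σ₁ hcoord hσσ hσ₁j hσ₁θ hϖ hσπ hsub
  have hlvl := level_of_eisenstein_pair_of_deep j θ hθ ha hϖ hk₁ hcoord hlam2 hu1 hp1 hqc hN hn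
  have hlvl' : (n = 2 * N + 1 ∧ c ∈ Ideal.span ({π ^ (N + 1)} : Set 𝒪[E])) ∨
      ∃ M : ℕ, 1 ≤ M ∧ M ≤ N ∧ n = 2 * M ∧ c ∈ Ideal.span ({π ^ M} : Set 𝒪[E]) ∧ c ∉ Ideal.span ({π ^ (M + 1)} : Set 𝒪[E]) := by
    rcases hlvl with h | ⟨M, hM1, hMN, hnM, -, hcM, hcM1⟩
    · exact Or.inl h
    · exact Or.inr ⟨M, hM1, hMN, hnM, hcM, hcM1⟩
  exact exists_map_rep_of_level j θ σO ιO hσσ hfixO hcoord htr hϖF hϖ hιϖ hherm hlvl' hR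

end Star

end Literature.NumberTheory.Automorphic

end
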